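import Literature.NumberTheory.Automorphic.UnitaryInductionCompleteReducibility   -- ★ `conj_mul_toFun_parabolicIndGL_mul`, ★ `integral_subgroup_comp_mul_right_eq` (via `ModulusInvariantIntegral`)
import Literature.NumberTheory.Rogawski1990.CMLocalAPacketMembers                 -- ★ `Rogawski1990.splitMemberGL`
import Summits.HodgeConjecture.HodgeConjecture.Theorems.F0P3AdmissibleUnitaryComplement   -- ★ `isUnitarizable_of_inner_map_map`
import HarnessLib

/-!
# Crux `H413` — (Ob1) pay-down line «XiLocalPacketUnitary», stub (i): the split-place member `i_G(ξ_w)` on `GL₃(F)` is UNITARIZABLE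
# (unitary parabolic induction on `GL_N(F)` carries an invariant positive-definite Hermitian form; Cartier 1979 Thm. 3.2 (c))

Cell `hodgecm-mathlib`, F0∕P3 «U3-mult», crux item stmt-HodgeConjecture-24833 (`HCCMUnconditional.H413`); pay-down line
`Cruxes/H413/Lines/F0_P3b_XiLocalPacketUnitaryPaydown.lean` (F0P3b-plan (g8), director s561 (1)), stub (i)
`stub_splitMemberGL_isUnitarizable`; seat F0P3-p01 (g9).  PROOF lane (`--supports stmt-HodgeConjecture-24833 --as helper`): theorems only,
no `def`, no named fact, no instance, no notation, no `sorry`.  HONEST LABEL: HC_CM is proved only modulo the printed citations until rung 0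
closes; this file discharges clause (i) of the letter «XiLocalPacketUnitary» only through the line's composition `xiLocalPacketUnitary_of_stubs`.

THE MATHEMATICS (Cartier 1979, Thm. 3.2 (c) with formulas (9)–(11); Bushnell–Henniart 2006 §11.1; Bernstein–Zelevinsky 1977 Prop. 2.3).
Let `F` be a non-archimedean local field, `c : Fin N → α` a block labelling with standard parabolic `P_c ≤ GL_N(F)`, and `χ` a UNIT-NORM
character of the standard Levi `Π_a GL_{n_a}(F)`.  The normalised induced representation `i_c(𝟙 ⊗ χ) = Ind_{P_c}^{GL_N}(χ ∘ proj ⊗ δ_{P_c}^{1/2})`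
(★ `Representation.parabolicIndGL F c ((trivial ℂ _ ℂ).twist χ)`) carries the form `(f₁ | f₂) = ∫_{K₀} conj f₁(k) · f₂(k) dμ_{K₀}`, `K₀ ≤ GL_N(F)`
compact open with `GL_N(F) = P_c K₀` (Iwasawa, ★ `exists_isCompact_isOpen_forall_standardParabolicGL_mul`).  It is positive definite Hermitian
(a function of `i_c` vanishing on `K₀` vanishes, by `G = P_c K₀`) and `GL_N(F)`-invariant: `conj f₁ · f₂ ∈ Ind(Δ_{P_c})`
(★ `conj_mul_toFun_parabolicIndGL_mul`: `(δ^{1/2})² = Δ_{P_c}` and `|χ| = 1`), and on `Ind(Δ_{P_c})` the `K₀`-integral is the invariant linear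
form (★ `integral_subgroup_comp_mul_right_eq`, from the `G = HK` integration formula and the unimodularity of `GL_N(F)`,
★ `GLn.isMulRightInvariant_of_isHaarMeasure_local`).  This is, word for word, the inner product built inside the proof of
★ `isSemisimpleRepresentation_parabolicIndGL_twist` (`Literature/NumberTheory/Automorphic/UnitaryInductionCompleteReducibility.lean`);
here the conclusion drawn from it is ★ `Representation.IsUnitarizable` (via ★ `isUnitarizable_of_inner_map_map`) instead of complete
reducibility — in particular NO smoothness ∕ open-kernel hypothesis on `χ` is needed (admissibility is not used).

* §1 private point-set instances on `GL_N(F)` (Hausdorff, locally compact, second countable), copied from the source file (not exported there).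
* §2 **`isUnitarizable_parabolicIndGL_twist`** — `i_c(𝟙 ⊗ χ)` is unitarizable for every block labelling `c` and every unit-norm Levi character `χ`.
* §3 **`isUnitarizable_parabolicIndGL_detChar`** — the Zelevinsky datum `(ν₀ ∘ det_{GL_{N-1}}) ⊠ χ′` of `Q_{N-1,1}` (★ `Zelevinsky1980.maxParabolicLeviChar`)
  for unit-norm `ν₀, χ′ : Fˣ → ℂˣ`.
* §4 **`splitMemberGL_isUnitarizable`** — the stub (i) text: `(Rogawski1990.splitMemberGL F ν₀ χ′ hν₀u hν₀c hχ′u hχ′c).ρ.IsUnitarizable`, binders verbatim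
  from ★ `Rogawski1990.splitMemberGL` (`CMLocalAPacketMembers` :76); its `ρ` field IS §3 at `N = 3` (`rfl`).

References: [Cartier1979] §III.3.3, Thm. 3.2 (c), formulas (8)–(11), p. 136 (unitarity p. 150); [BushnellHenniart2006] §11.1 (proof of 11.1 Prop.);
[BernsteinZelevinsky1977] Prop. 2.3 p. 447; [Rogawski1990] §12.2 (1) p. 173, §13.3 p. 201 (split places: `i_G(ξ_w)`); [Zelevinsky1980] §3.2, Thm. 4.2.
-/

set_option autoImplicit false
-- the mandated namespace repeats `HodgeConjecture.HodgeConjecture`, as in every `Theorems/*.lean` of this sub-problem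
set_option linter.dupNamespace false

noncomputable section

open MeasureTheory Measure Set Filter Topology
open scoped NNReal ENNReal ComplexConjugate InnerProductSpace
open Literature.NumberTheory Literature.NumberTheory.Automorphic
open Summit.HodgeConjecture.HodgeConjecture.Cruxes.H413.F0P3AdmissibleUnitaryComplement (isUnitarizable_of_inner_map_map)

namespace Summit.HodgeConjecture.HodgeConjecture.Cruxes.H413.F0P3bSplitMemberUnitarizable

/-! ## §1 Point-set instances on `GL_N(F)` -/

section GLn

variable (F : Type*) [Field F] [ValuativeRel F] [TopologicalSpace F] [IsNonarchimedeanLocalField F]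

/-- `GL_N(F)` is Hausdorff (invoked with `haveI`; copy of the source file's private `t2Space_glLocalField`). [folklore] -/
private theorem t2Space_glLocalField (N : ℕ) : T2Space (GL (Fin N) F) := by
  haveI : T2Space F := (GaloisRepresentations.IsNonarchimedeanLocalField.isLocalField F).toT2Space
  infer_instance

/-- `GL_N(F)` is locally compact (closed in `M_N(F) × M_N(F)ᵐᵒᵖ`; copy of the source file's private lemma). [folklore] -/
private theorem locallyCompactSpace_glLocalField (N : ℕ) : LocallyCompactSpace (GL (Fin N) F) := by
  haveI : T2Space F := (GaloisRepresentations.IsNonarchimedeanLocalField.isLocalField F).toT2Space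
  haveI : LocallyCompactSpace (Matrix (Fin N) (Fin N) F) :=
    inferInstanceAs (LocallyCompactSpace (Fin N → Fin N → F))
  haveI : LocallyCompactSpace (Matrix (Fin N) (Fin N) F)ᵐᵒᵖ :=
    MulOpposite.opHomeomorph.symm.isClosedEmbedding.locallyCompactSpace
  exact Units.isClosedEmbedding_embedProduct.locallyCompactSpace

/-- `GL_N(F)` is second countable (copy of the source file's private lemma). [folklore] -/
private theorem secondCountableTopology_glLocalField (N : ℕ) :
    SecondCountableTopology (GL (Fin N) F) := by
  haveI := secondCountableTopology_localField F
  haveI : SecondCountableTopology (Matrix (Fin N) (Fin N) F) :=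
    inferInstanceAs (SecondCountableTopology (Fin N → Fin N → F))
  haveI : SecondCountableTopology (Matrix (Fin N) (Fin N) F)ᵐᵒᵖ :=
    MulOpposite.opHomeomorph.symm.secondCountableTopology
  exact Units.isEmbedding_embedProduct.secondCountableTopology

/-! ## §2 Unitary parabolic induction on `GL_N(F)` is unitarizable -/

variable {N : ℕ} {α : Type*} [LinearOrder α] (c : Fin N → α) [LocallyCompactSpace (standardParabolicGL F c)]

/-- **Unitary parabolic induction on `GL_N(F)` is unitarizable.** Let `F` be a non-archimedean local field, `c : Fin N → α` a block
labelling with standard parabolic `P_c ≤ GL_N(F)`, and `χ` a character of the standard Levi `Π_a GL_{n_a}(F)` of UNIT NORM (`‖χ‖ = 1`).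
Then the normalised induced representation `i_c(𝟙 ⊗ χ) = Ind_{P_c}^{GL_N}(χ ∘ proj ⊗ δ_{P_c}^{1/2})` (★ `Representation.parabolicIndGL`) is
unitarizable (★ `Representation.IsUnitarizable`: an invariant positive-definite Hermitian sesquilinear form).  The form is
`(f₁ | f₂) = ∫_{K₀} conj f₁(k) f₂(k) dμ_{K₀}` for a compact open `K₀` with `GL_N(F) = P_c K₀` (Iwasawa); positive definite because a function of
`i_c` vanishing on `K₀` vanishes; invariant by ★ `integral_subgroup_comp_mul_right_eq` applied to `conj f₁ · f₂ ∈ Ind(Δ_{P_c})`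
(★ `conj_mul_toFun_parabolicIndGL_mul`, unimodularity of `GL_N(F)`).  No smoothness hypothesis on `χ` is needed.
[cite: Cartier1979, Thm. 3.2 (c) with (9)–(11), p. 136] [cite: BushnellHenniart2006, §11.1] -/
theorem isUnitarizable_parabolicIndGL_twist (χ : (Π a, GL {i // c i = a} F) →* ℂˣ)
    (hχu : ∀ m, ‖((χ m : ℂˣ) : ℂ)‖ = 1) :
    (Representation.parabolicIndGL F c
      ((Representation.trivial ℂ (Π a, GL {i // c i = a} F) ℂ).twist χ)).IsUnitarizable := by
  classical
  -- notation and the point-set / measure-theoretic instances on `G = GL_N(F)`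
  set P : Subgroup (GL (Fin N) F) := standardParabolicGL F c with hPdef
  haveI : T2Space (GL (Fin N) F) := t2Space_glLocalField F N
  haveI : LocallyCompactSpace (GL (Fin N) F) := locallyCompactSpace_glLocalField F N
  haveI : SecondCountableTopology (GL (Fin N) F) := secondCountableTopology_glLocalField F N
  letI : MeasurableSpace (GL (Fin N) F) := borel _
  haveI : BorelSpace (GL (Fin N) F) := ⟨rfl⟩
  have hPc : IsClosed (P : Set (GL (Fin N) F)) := isClosed_standardParabolicGL F c
  -- Iwasawa decomposition `G = P K₀` with `K₀` compact open, and the Haar measures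
  obtain ⟨K₀, hK₀c, hK₀o, hPK₀⟩ := exists_isCompact_isOpen_forall_standardParabolicGL_mul F c
  haveI : CompactSpace K₀ := isCompact_iff_compactSpace.1 hK₀c
  set μG : Measure (GL (Fin N) F) := Measure.haar with hμG
  set μK : Measure K₀ := Measure.haar with hμK
  haveI : μG.IsMulRightInvariant := GLn.isMulRightInvariant_of_isHaarMeasure_local N F μG
  -- the representation and the underlying functions
  set σ : Representation ℂ (Π a, GL {i // c i = a} F) ℂ :=
    (Representation.trivial ℂ (Π a, GL {i // c i = a} F) ℂ).twist χ with hσ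
  -- `τ σ' = σ' ∘ proj ⊗ δ^{1/2}`, the representation of `P` that is induced
  let τ : Representation ℂ (Π a, GL {i // c i = a} F) ℂ → Representation ℂ P ℂ := fun σ' =>
    Representation.twist (σ'.comp (leviProjection F c)) (rootDeltaChar P)
  set ρ := Representation.parabolicIndGL F c σ with hρ
  -- continuity and integrability on `K₀` of the functions `k ↦ conj (f₁ k) * f₂ k`
  have hcont : ∀ f : Representation.SmoothInd P (τ σ), Continuous f.toFun := fun f =>
    (Representation.SmoothInd.isLocallyConstant_toFun f).continuous
  have hint : ∀ f₁ f₂ : Representation.SmoothInd P (τ σ),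
      Integrable (fun k : K₀ => conj (f₁.toFun k) * f₂.toFun k) μK := by
    intro f₁ f₂
    have hc : Continuous fun k : K₀ => conj (f₁.toFun k) * f₂.toFun k :=
      ((Complex.continuous_conj.comp ((hcont f₁).comp continuous_subtype_val)).mul
        ((hcont f₂).comp continuous_subtype_val))
    exact hc.integrable_of_hasCompactSupport (HasCompactSupport.of_compactSpace _)
  -- the inner product
  let ip : Representation.SmoothInd P (τ σ) → Representation.SmoothInd P (τ σ) → ℂ :=
    fun f₁ f₂ => ∫ k : K₀, conj (f₁.toFun k) * f₂.toFun k ∂μK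
  have ip_self : ∀ f, ip f f = ((∫ k : K₀, ‖f.toFun k‖ ^ 2 ∂μK : ℝ) : ℂ) := by
    intro f
    show ∫ k : K₀, conj (f.toFun k) * f.toFun k ∂μK = _
    rw [← integral_complex_ofReal]
    refine integral_congr_ae (Eventually.of_forall fun k => ?_)
    show conj (f.toFun k) * f.toFun k = ((‖f.toFun k‖ ^ 2 : ℝ) : ℂ)
    rw [mul_comm, Complex.mul_conj, Complex.normSq_eq_norm_sq, Complex.ofReal_pow]
  let core : InnerProductSpace.Core ℂ (Representation.SmoothInd P (τ σ)) :=
    { inner := ip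
      conj_inner_symm := fun f₁ f₂ => by
        show conj (∫ k : K₀, conj (f₂.toFun k) * f₁.toFun k ∂μK) =
          ∫ k : K₀, conj (f₁.toFun k) * f₂.toFun k ∂μK
        rw [← integral_conj]
        refine integral_congr_ae (Eventually.of_forall fun k => ?_)
        simp [mul_comm]
      re_inner_nonneg := fun f => by
        show 0 ≤ RCLike.re (ip f f)
        rw [ip_self]
        simp only [RCLike.re_to_complex, Complex.ofReal_re]
        exact integral_nonneg fun k => by positivity
      add_left := fun f₁ f₂ f₃ => by
        show ∫ k : K₀, conj ((f₁ + f₂).toFun k) * f₃.toFun k ∂μK =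
          ∫ k : K₀, conj (f₁.toFun k) * f₃.toFun k ∂μK +
            ∫ k : K₀, conj (f₂.toFun k) * f₃.toFun k ∂μK
        rw [← integral_add (hint f₁ f₃) (hint f₂ f₃)]
        refine integral_congr_ae (Eventually.of_forall fun k => ?_)
        simp only [Representation.SmoothInd.toFun_add, Pi.add_apply, map_add, add_mul]
      smul_left := fun f₁ f₂ r => by
        show ∫ k : K₀, conj ((r • f₁).toFun k) * f₂.toFun k ∂μK =
          conj r * ∫ k : K₀, conj (f₁.toFun k) * f₂.toFun k ∂μK
        rw [← integral_const_mul]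
        refine integral_congr_ae (Eventually.of_forall fun k => ?_)
        simp only [Representation.SmoothInd.toFun_smul, Pi.smul_apply, smul_eq_mul, map_mul,
          mul_assoc]
      definite := fun f hf => by
        have h0 : (∫ k : K₀, ‖f.toFun k‖ ^ 2 ∂μK) = 0 := by
          have := ip_self f
          rw [show ip f f = 0 from hf] at this
          exact_mod_cast this.symm
        have hc2 : Continuous fun k : K₀ => ‖f.toFun k‖ ^ 2 :=
          (((hcont f).comp continuous_subtype_val).norm).pow 2
        have hnn : 0 ≤ fun k : K₀ => ‖f.toFun k‖ ^ 2 := fun k => by positivity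
        have hae := (integral_eq_zero_iff_of_nonneg hnn
          (hc2.integrable_of_hasCompactSupport (HasCompactSupport.of_compactSpace _))).1 h0
        have hzero : ∀ k : K₀, f.toFun k = 0 := by
          have heq : (fun k : K₀ => ‖f.toFun k‖ ^ 2) = fun _ => (0 : ℝ) :=
            Continuous.ae_eq_iff_eq μK hc2 continuous_const |>.1 hae
          intro k
          have := congrFun heq k
          simpa using this
        apply Representation.SmoothInd.ext
        funext x
        obtain ⟨p, hp, k, hk, rfl⟩ := hPK₀ x
        rw [Representation.SmoothInd.toFun_zero, Pi.zero_apply,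
          show p * k = ((⟨p, hp⟩ : P) : GL (Fin N) F) * k from rfl,
          Representation.SmoothInd.toFun_subgroup_mul, hzero ⟨k, hk⟩, map_zero] }
  letI : NormedAddCommGroup (Representation.SmoothInd P (τ σ)) :=
    @InnerProductSpace.Core.toNormedAddCommGroup ℂ _ _ _ _ core
  letI : InnerProductSpace ℂ (Representation.SmoothInd P (τ σ)) := InnerProductSpace.ofCore core.toCore
  -- invariance of the inner product
  have hU : ∀ (g : GL (Fin N) F) (f₁ f₂ : Representation.SmoothInd P (τ σ)),
      ⟪ρ g f₁, ρ g f₂⟫_ℂ = ⟪f₁, f₂⟫_ℂ := by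
    intro g f₁ f₂
    show ∫ k : K₀, conj ((ρ g f₁).toFun k) * (ρ g f₂).toFun k ∂μK =
      ∫ k : K₀, conj (f₁.toFun k) * f₂.toFun k ∂μK
    have h := integral_subgroup_comp_mul_right_eq (H := P) (K := K₀) hPc hK₀o hK₀c hPK₀ μG μK
      (fun x => conj (f₁.toFun x) * f₂.toFun x)
      ((Complex.continuous_conj.comp (hcont f₁)).mul (hcont f₂))
      (fun p x => conj_mul_toFun_parabolicIndGL_mul F c χ hχu f₁ f₂ p x) g
    simpa [hρ, Representation.parabolicIndGL, Representation.toFun_smoothIndRep_apply] using h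
  -- conclusion: the inner product is an invariant positive-definite Hermitian form
  exact isUnitarizable_of_inner_map_map (ρ := ρ) hU

end GLn

/-! ## §3 The Zelevinsky datum `(ν₀ ∘ det_{GL_{N-1}}) ⊠ χ′` of `Q_{N-1,1}` -/

section Zelevinsky

variable (F : Type*) [Field F] [ValuativeRel F] [TopologicalSpace F] [IsNonarchimedeanLocalField F]

/-- **`(ν₀ ∘ det_{GL_{N-1}}) × χ′` is unitarizable for unit-norm `ν₀, χ′`.** For a non-archimedean local field `F`, `N : ℕ` and UNIT-NORM
characters `ν₀, χ′ : Fˣ → ℂˣ`, the normalised induced representation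
`parabolicIndGL F (lastBlockLabel N) ((trivial).twist (maxParabolicLeviChar F N ν₀ χ′))` of `GL_N(F)` (the representation of the named fact
★ `Zelevinsky1980.parabolicIndGL_detChar_unitary_isIrreducible`) is unitarizable: §2 for the Levi character
`(m_a) ↦ ν₀(det m_false) χ′(det m_true)`, which has unit norm (★ `Zelevinsky1980.maxParabolicLeviChar_apply`).  Continuity of `ν₀, χ′` is NOT needed.
[cite: Cartier1979, Thm. 3.2 (c) with (9)–(11), p. 136] [cite: BernsteinZelevinsky1977, Prop. 2.3] -/
theorem isUnitarizable_parabolicIndGL_detChar (N : ℕ)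
    [LocallyCompactSpace (standardParabolicGL F (Zelevinsky1980.lastBlockLabel N))]
    (ν₀ χ' : Fˣ →* ℂˣ) (hν₀u : ∀ x, ‖((ν₀ x : ℂˣ) : ℂ)‖ = 1) (hχ'u : ∀ x, ‖((χ' x : ℂˣ) : ℂ)‖ = 1) :
    (Representation.parabolicIndGL F (Zelevinsky1980.lastBlockLabel N)
      ((Representation.trivial ℂ (Π a : Bool, GL {i : Fin N // Zelevinsky1980.lastBlockLabel N i = a} F) ℂ).twist
        (Zelevinsky1980.maxParabolicLeviChar F N ν₀ χ'))).IsUnitarizable := by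
  refine isUnitarizable_parabolicIndGL_twist F (Zelevinsky1980.lastBlockLabel N)
    (Zelevinsky1980.maxParabolicLeviChar F N ν₀ χ') (fun m => ?_)
  rw [Zelevinsky1980.maxParabolicLeviChar_apply, Units.val_mul, norm_mul, hν₀u, hχ'u, mul_one]

end Zelevinsky

/-! ## §4 Stub (i) of the pay-down line: `i_G(ξ_w)` on `GL₃(F)` is unitarizable -/

/-- **STUB (i) — `i_G(ξ_w) = (ν₀ ∘ det_{GL₂}) × χ′` on `GL₃(F)` is unitarizable** (normalised parabolic induction from unit-norm continuous
characters `ν₀ ∘ det_{GL₂}`, `χ′`; binders verbatim from ★ `Rogawski1990.splitMemberGL`, whose `ρ` field is the representation of §3 at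
`N = 3`).  This is the text of `stub_splitMemberGL_isUnitarizable` of `Cruxes/H413/Lines/F0_P3b_XiLocalPacketUnitaryPaydown.lean`; clause (i) of
the letter «XiLocalPacketUnitary» follows by transport along `cmSplitEquiv` in the line's composition `xiLocalPacketUnitary_of_stubs`.
[cite: BushnellHenniart2006, §11.1] [cite: BernsteinZelevinsky1977, Prop. 2.3] [cite: Rogawski1990, §12.2 (1) p. 173] [cite: Cartier1979, §III.3 Thm. 3.2 (c) p. 136] -/
theorem splitMemberGL_isUnitarizable (F : Type) [Field F] [ValuativeRel F] [TopologicalSpace F] [IsNonarchimedeanLocalField F]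
    [LocallyCompactSpace (standardParabolicGL F (Zelevinsky1980.lastBlockLabel 3))]
    (ν₀ χ' : Fˣ →* ℂˣ) (hν₀u : ∀ x, ‖((ν₀ x : ℂˣ) : ℂ)‖ = 1) (hν₀c : Continuous fun x => ((ν₀ x : ℂˣ) : ℂ))
    (hχ'u : ∀ x, ‖((χ' x : ℂˣ) : ℂ)‖ = 1) (hχ'c : Continuous fun x => ((χ' x : ℂˣ) : ℂ)) :
    (Rogawski1990.splitMemberGL F ν₀ χ' hν₀u hν₀c hχ'u hχ'c).ρ.IsUnitarizable :=
  isUnitarizable_parabolicIndGL_detChar F 3 ν₀ χ' hν₀u hχ'u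

end Summit.HodgeConjecture.HodgeConjecture.Cruxes.H413.F0P3bSplitMemberUnitarizable

end
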